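import Literature.MathematicalPhysics.QuantumFieldTheory.Balaban1983to89.B8LeafKnitZd3LettersRD
import Literature.MathematicalPhysics.QuantumFieldTheory.Balaban1983to89.B8SockP5uEAssemblyB

/-!
# `Balaban1983to89.B8LeafKnitZd3LettersRDB` — [Balaban1985RegularSpaces] Lemma 1 – Thm 8: THE N05 KNIT WITH THE PROPOSITION-5 SOCKETS SERVED BY [4]'s
# LETTERS ON PRINT'S DOMAINS, UNIQUENESS LETTERS WITH THE LEFT-INVERSE LAW OF `G′` ON BOUNDED FUNCTIONS (the W8″ guard) — this seat's g2
# `B8LeafKnitZd3LettersRD` §2 re-run on `B8SockP5uEAssemblyB.exists_threshold_sockP5uEB`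

statement-level skeleton of published theorems with citation tags; proofs where landed; nothing here is a claim about the
Yang–Mills mass gap

PDF held: `paper:balaban1985-cmp99-regular-spaces-gauge-fixing` (journal page = PDF page + 74); Prop. 5 p. 94, Thm 4 p. 88, Thm 2 p. 83; [4] =
[Balaban1985BackgroundPropagators] Thm 3.1 p. 397.

WHY THIS FILE (cell `pub-ymgap`, HUMAN RULING D-0062; R134 acceleration seat `pub-ymgap-dag-n05-d` (g3); (L2) of this seat's g2 LOCATED list).  The
uniqueness-letters binder `SLetU` of `B8LeafKnitZd3LettersRD.b8LeafRS_zd3_map_lettersRDU` / `thm2_of135_zd3_map_lettersRDU` (p467425) carries the TOTAL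
left-inverse law of `G′`, which has no model at the `Ω 0 = univ` members the knit ranges over (`hΩ : (ι j).Ω 0 = univ`) — so those two theorems are
VACUOUS as typed (INBOX W8″, dag-ref-A READ-24 (4)).  THIS FILE is their repair: **`b8LeafRS_zd3_map_lettersRDUB`**, **`thm2_of135_zd3_map_lettersRDUB`** —
the same statements with conjunct 1 of `SLetUB` asking the identity for BOUNDED inputs only ([4] Thm 3.1 p. 397 as printed), the uniqueness socket
`SockP5uE` being served by `B8SockP5uEAssemblyB.exists_threshold_sockP5uEB` (guarded engine `B8Prop5UniqSectEW` / `B8Prop5UniqKLevelB`); proofs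
verbatim otherwise.  Consumers: `Summits/…/BalabanUVNodesN05SubBKnit` v1.2 (the SubB knit and the cube-slot discharge with the guarded family), then
the `zdLan` faces.

HONEST SCOPE.  A one-binder typing repair + re-run; [4]'s letters (both families) and the b9 socket stay HYPOTHESES; nothing of [4], Sect. E or the
contraction is proved beyond composition; count-neutral; N05 NOT discharged; one finite T⁴ programme at fixed ε; nothing continuum / ℝ⁴ / OS /
mass-gap / Clay.  Unit `pub-ymgap-dag-n05-d` (g3), 2026-08-27.  No `sorry`, no `def`, no `instance`, no `notation`.
-/

noncomputable section

open NormedSpace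

namespace Literature.MathematicalPhysics.QuantumFieldTheory.Balaban1983to89.B8LeafKnitZd3LettersRDB

open B7Prop1Explicit B7Prop2Explicit B7Prop1Local
open B8Ineq132 (InAk BondTouches Under)
open B8Lemma1NonAbelian (mulCfg blockPairNA)
open B8Ineq130 (tlo thi)
open B8LeafKnitRS (B8LeafRS)
open B8LeafModelZd (ZdIdx)
open B8LeafModelZdSockP5uE (SockP5uE)
open B8LeafModelZd3 (zdGF3 SockB9P3)
open B8SockLettersRD (SockLettersRD)
open B8SockHFPRD (exists_threshold_sockHFP_pairRD)
open B8SockP5uEAssemblyB (exists_threshold_sockP5uEB)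
open B8Ineq132 (covDerivFwd)
open B7Eq78Linearization (zdBlocking QprimeIter)
open B8Eq119TwistedAxial (bgT)
open B8Eq140Level (SideTouches)
open B8Eq138LandauZd (covLap QT)
open B8Eq1117Concrete (XSpace)
open B8Prop5ContractionKLevel (Bd2)
open B8LambdaSpaceKLevel (wt)
open B8LeafKnitZd3E (b8LeafRS_zd3_map_b9allE thm2_of135_zd3_map_b9allE)
open QuantumLattice (blockSites)

-- `Site` alone could resolve to the torus sites of `Setup.lean`; re-export the `ℤ^d` sites of `B7Prop1Explicit`.
export B7Prop1Explicit (Site)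


variable {d : ℕ}

/-! ## The N05 knits with the GUARDED uniqueness-letters family -/

section KnitRDUB

variable {𝔸 : Type} [CStarAlgebra 𝔸] [Nontrivial 𝔸]
variable {I₃ I₄ : Type} {lan : I₃ → B8.LandauData} {cub : I₄ → B8.CubeData}

/-- **THE N05 KNIT OVER AN INDEX MAP `ι` WITH NO PROPOSITION-5 SOCKET LEFT, LETTERS ON PRINT'S DOMAINS, UNIQUENESS LETTERS GUARDED** — this seat's g2 `b8LeafRS_zd3_map_lettersRDU` VERBATIM except that conjunct 1 of the uniqueness-letters binder is [4]'s left-inverse law of `G′` ON BOUNDED FUNCTIONS (`∀ x, (∃ C, ∀ y, ‖x y‖ ≤ C) → G′(Δx + Q′ᵀ𝔄Q′x) = x`, Thm 3.1 p. 397; the total law is unservable at `Ω 0 = univ`, W8″) and the uniqueness socket is served by `B8SockP5uEAssemblyB.exists_threshold_sockP5uEB`; as there: `b8LeafRS_zd3_map_lettersRD` with its uniqueness binder `SP5u : ∀ j, SockP5uE L inp.B₀ cu′ cu …`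
DISCHARGED by `B8SockP5uEAssembly.exists_threshold_sockP5uE` (n04-b g5: Prop. 5's uniqueness clause (1.109) at ONE radius `c_u` and ONE threshold for the whole `Ω 0 = univ`
sub-family) from the UNIQUENESS-LETTERS FAMILY `SLetU` at every `ι j` — [4]'s letters `G′, Δ, Q′, Q′ᵀ, 𝔄, C, H′` at the top structure `(k, Λs k)` with the twelve laws n04-b
displays verbatim (`g_left`, the left inverse of `C` in range form `c_left′`, the readings `hΔ hqs hq`, `Q′` ZERO off `𝔅_k`, (1.92) `hH0 hH1 hH2`, (1.91) `hQH`, (1.101) `hG`,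
(1.98) `hRbd`) — and the b9 socket `SB9all` the knit already carries.  Remaining hypotheses: `SockLettersRD` (existence side, laws on print's domains) and `SLetU` (uniqueness side)
at every `ι j` — both [4] Thms 3.1–3.3 for Bałaban's operators — `SB9all` at every `ι j`, the member laws (L1)/(L2), `Ω₀ = ℤᵈ`, `3·(2dL²)·B_G·B_R ≤ inp.B₀′`, and `p5e p5u p6 p7 t8S`.
NOT a discharge of N05. [cite: Balaban1985RegularSpaces, Lemma 1 p.79, Thm 2 p.83, Prop. 3 p.87, Thm 4 p.88, Prop. 5 (1.106)–(1.109) p.94 («c₂, c₃»), (1.102)–(1.103) p.93; Prop. 6 p.99, Prop. 7 p.100, Thm 8 p.101 (named hypotheses); Balaban1985BackgroundPropagators, Thms 3.1–3.3 pp.397–398, (3.25) p.394] -/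
theorem b8LeafRS_zd3_map_lettersRDUB (hd2 : 2 ≤ d) {L : ℕ} (hL : 2 ≤ L) (Lb : ℕ) (β : ℝ) (len : Site d → ℝ) (inp : B8.B9Inputs)
    {B₀β C₂ cB9 B₁ B₂ c₁ B₀'H B₂' BG BR cL : ℝ} (hB : 2 ≤ 5 * (d : ℝ) * L * inp.B₀) (hB₀β : 0 < B₀β)
    (hC₂ : 2097152 * ((d : ℝ) + 1) ^ 2 ≤ C₂) (hcB9 : 0 < cB9)
    (hB₀'H : 0 < B₀'H) (hB₂' : 0 ≤ B₂') (hBG : 0 ≤ BG) (hBR : 0 ≤ BR) (hcL : 0 < cL)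
    (hfree : 3 * (2 * (d : ℝ) * (L : ℝ) ^ 2) * BG * BR ≤ inp.B₀')
    {J : Type} (ι : J → ZdIdx d L) (hΩ : ∀ j, (ι j).Ω 0 = Set.univ)
    -- the two member laws the letters route reads, at every member of the map
    (hL1 : ∀ j : J, ∀ m, m ≤ (ι j).k → ∀ n, n ≤ m → ∀ y ∈ (ι j).Λs m n, ∀ x, InBox (tlo L y n) (thi L y n) x → x ∈ (ι j).Ω n)
    (hL2lt : ∀ j : J, ∀ m, m < (ι j).k → ∀ n, n < m → (ι j).Λs m n = (ι j).Λs (m + 1) n)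
    (hL2top : ∀ j : J, ∀ m, m < (ι j).k → ∀ x, x ∈ (ι j).Λs m m ↔ x ∈ (ι j).Λs (m + 1) m ∨ ∃ y ∈ (ι j).Λs (m + 1) (m + 1), x ∈ blockSites L y)
    -- [4]'s letters at every member of the map: existence side (laws on print's domains) and uniqueness side (n04-b's twelve laws at the top structure)
    (SLet : ∀ j : J, SockLettersRD (𝔸 := 𝔸) L BG BR B₀'H B₂' cL (ι j).η (ι j).k (ι j).Ω (ι j).Λs)
    (SLetUB : ∀ j : J, ∀ α₀ : ℝ, 0 < α₀ → α₀ ≤ cL → ∀ U₀ : Site d → Fin d → 𝔸ˣ, (∀ x κ, U₀ x κ ∈ unitaryUnits 𝔸) →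
      InAk L (ι j).k (ι j).η α₀ (ι j).Ω U₀ →
      ∃ (g Δ : (Site d → 𝔸) →ₗ[ℂ] (Site d → 𝔸)) (q : (Site d → 𝔸) →ₗ[ℂ] (ℕ → Site d → 𝔸)) (qs : (ℕ → Site d → 𝔸) →ₗ[ℂ] (Site d → 𝔸))
        (Aw c : (ℕ → Site d → 𝔸) →ₗ[ℂ] (ℕ → Site d → 𝔸)) (H' : XSpace d (ι j).k 𝔸 →ₗ[ℂ] (Site d → 𝔸)),
        (∀ x : Site d → 𝔸, (∃ C : ℝ, ∀ y, ‖x y‖ ≤ C) → g (Δ x + qs (Aw (q x))) = x) ∧ (∀ φ, qs (c (q (g (g (qs φ))))) = qs φ) ∧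
        (∀ (f : Site d → 𝔸), ∀ x ∈ (ι j).Ω 0, Δ f x = covLap (ι j).η U₀ (((ι j).Ω 0).indicator f) x) ∧
        (∀ (μ : ℕ → Site d → 𝔸), ∀ x ∈ (ι j).Ω 0, qs μ x = QT L (ι j).k ((ι j).Λs (ι j).k) U₀ μ x) ∧
        (∀ (f : Site d → 𝔸) (n : ℕ), n ≤ (ι j).k → ∀ y ∈ (ι j).Λs (ι j).k n, q f n y = QprimeIter (zdBlocking d L) (bgT L U₀) n f y) ∧
        (∀ (f : Site d → 𝔸) (n : ℕ) (y : Site d), ¬ (n ≤ (ι j).k ∧ y ∈ (ι j).Λs (ι j).k n) → q f n y = 0) ∧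
        (∀ (X : XSpace d (ι j).k 𝔸) (x : Site d), ‖H' X x‖ ≤ B₀'H * ‖X‖) ∧
        (∀ n, n ≤ (ι j).k → ∀ (X : XSpace d (ι j).k 𝔸), ∀ p ∈ {b : Site d × Fin d | SideTouches ((ι j).Ω n) b.1 b.2},
          wt L (ι j).η n * ‖covDerivFwd (ι j).η U₀ p.2 (H' X) p.1‖ ≤ B₀'H * ‖X‖) ∧
        (∀ X : XSpace d (ι j).k 𝔸, Bd2 L (ι j).η (ι j).k (ι j).Ω (covLap (ι j).η U₀ (H' X)) (B₂' * ‖X‖)) ∧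
        (∀ (Y : XSpace d (ι j).k 𝔸) (n : ℕ) (hn : n ≤ (ι j).k) (y : Site d), y ∈ (ι j).Λs (ι j).k n →
          QprimeIter (zdBlocking d L) (bgT L U₀) n (H' Y) y = Y (⟨n, Nat.lt_succ_of_le hn⟩, y)) ∧
        (∀ (f : Site d → 𝔸) (r : ℝ), 0 ≤ r → Bd2 L (ι j).η (ι j).k (ι j).Ω f r →
          (∀ x, ‖g f x‖ ≤ BG * r) ∧ ∀ n, n ≤ (ι j).k → ∀ p ∈ {b : Site d × Fin d | SideTouches ((ι j).Ω n) b.1 b.2},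
            wt L (ι j).η n * ‖covDerivFwd (ι j).η U₀ p.2 (g f) p.1‖ ≤ BG * r) ∧
        (∀ (f : Site d → 𝔸) (r : ℝ), 0 ≤ r → Bd2 L (ι j).η (ι j).k (ι j).Ω f r → Bd2 L (ι j).η (ι j).k (ι j).Ω (f - g (qs (c (q (g f))))) (BR * r)))
    (SB9all : ∀ j : J, ∀ m, m ≤ (ι j).k → SockB9P3 (𝔸 := 𝔸) L inp.B₀ B₀β cB9 β len (ι j).η m (ι j).Ω (ι j).Λs (ι j).Λb)
    {toAxial : ∀ j : J, (zdGF3 𝔸 L β len (ι j)).Cfg → (zdGF3 𝔸 L β len (ι j)).Pert → (zdGF3 𝔸 L β len (ι j)).Pert}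
    (p5e : B8.Prop5Exists inp.B₀' B₁ lan) (p5u : B8.Prop5Unique lan) (p6 : B8.Prop6Printed d (L : ℝ) B₁ c₁ cub)
    (p7 : B8SectGH.Prop7PrintedR (fun j : J => zdGF3 𝔸 L β len (ι j)) toAxial)
    (t8 : B8Thm8Surviving.Thm8SurvivingAt 1 B₁ B₂ (fun j : J => zdGF3 𝔸 L β len (ι j))) :
    B8LeafRS d (L : ℝ) C₂ (5 * (d : ℝ) * L * inp.B₀) inp.B₀' B₁ B₂ c₁ inp B₀β (blockPairNA d Lb 𝔸)
      (fun j : J => zdGF3 𝔸 L β len (ι j)) lan cub toAxial := by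
  obtain ⟨cF, hcF, hpair⟩ := exists_threshold_sockHFP_pairRD (𝔸 := 𝔸) hd2 hL inp.B₀_pos inp.B₀'_pos hB hB₀'H hB₂' hBG hBR hcB9 hcL hfree
  obtain ⟨cu, cFu, hcu, hcFu, huniq⟩ := exists_threshold_sockP5uEB (𝔸 := 𝔸) hd2 hL inp.B₀_pos hB hB₀'H hB₂' hBG hBR hcB9 hcL
  exact b8LeafRS_zd3_map_b9allE hd2 hL Lb β len inp hB hB₀β hC₂ hcu hcF hcF hcFu hcB9 ι hΩ
    (fun j => (hpair (ι j).hη (ι j).hk (ι j).hΩ (ι j).hbox (ι j).hclass (hL1 j) (hL2lt j) (hL2top j) (SLet j) (SB9all j)).1)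
    (fun j => (hpair (ι j).hη (ι j).hk (ι j).hΩ (ι j).hbox (ι j).hclass (hL1 j) (hL2lt j) (hL2top j) (SLet j) (SB9all j)).2)
    (fun j => huniq (ι j).hη (ι j).hk (ι j).hΩ (hΩ j) (ι j).hbox (ι j).hclass ((hL1 j) (ι j).k le_rfl) (SLetUB j) (SB9all j))
    SB9all p5e p5u p6 p7 t8

end KnitRDUB

section Thm2RDUB

variable {𝔸 : Type} [CStarAlgebra 𝔸] [Nontrivial 𝔸]

/-- **THEOREM 2 AS PRINTED ((1.35) on Λ_j; chair R453 (C)) OVER AN INDEX MAP `ι` WITH NO PROPOSITION-5 SOCKET LEFT, LETTERS ON PRINT'S DOMAINS, UNIQUENESS LETTERS GUARDED** — this seat's g2 `thm2_of135_zd3_map_lettersRDU` with conjunct 1 of `SLetUB` guarded (bounded inputs) and `exists_threshold_sockP5uEB`; as there: `thm2_of135_zd3_map_lettersRD`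
with the uniqueness binder `SP5u` DISCHARGED by n04-b's `exists_threshold_sockP5uE` from the uniqueness-letters family `SLetU` at every `ι j`; hypotheses as in
`b8LeafRS_zd3_map_lettersRDU` minus the leaf's
residual data. [cite: Balaban1985RegularSpaces, Thm 2 p.83, (1.35) p.82, (1.65) p.87, Thm 4 p.88, Prop. 5 (1.106)–(1.109) p.94, (1.59) p.86; Balaban1985BackgroundPropagators, Thms 3.1–3.3 pp.397–398] -/
theorem thm2_of135_zd3_map_lettersRDUB (hd2 : 2 ≤ d) {L : ℕ} (hL : 2 ≤ L) {β : ℝ} {len : Site d → ℝ}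
    {B₀ B₀' B₀β cB9 B₀'H B₂' BG BR cL : ℝ} (hB₀ : 0 < B₀) (hB₀' : 0 < B₀') (hB₀β : 0 < B₀β) (hB : 2 ≤ 5 * (d : ℝ) * L * B₀)
    (hcB9 : 0 < cB9) (hB₀'H : 0 < B₀'H) (hB₂' : 0 ≤ B₂') (hBG : 0 ≤ BG) (hBR : 0 ≤ BR) (hcL : 0 < cL)
    (hfree : 3 * (2 * (d : ℝ) * (L : ℝ) ^ 2) * BG * BR ≤ B₀')
    {J : Type} (ι : J → ZdIdx d L) (hΩ : ∀ j, (ι j).Ω 0 = Set.univ)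
    (hL1 : ∀ j : J, ∀ m, m ≤ (ι j).k → ∀ n, n ≤ m → ∀ y ∈ (ι j).Λs m n, ∀ x, InBox (tlo L y n) (thi L y n) x → x ∈ (ι j).Ω n)
    (hL2lt : ∀ j : J, ∀ m, m < (ι j).k → ∀ n, n < m → (ι j).Λs m n = (ι j).Λs (m + 1) n)
    (hL2top : ∀ j : J, ∀ m, m < (ι j).k → ∀ x, x ∈ (ι j).Λs m m ↔ x ∈ (ι j).Λs (m + 1) m ∨ ∃ y ∈ (ι j).Λs (m + 1) (m + 1), x ∈ blockSites L y)
    (SLet : ∀ j : J, SockLettersRD (𝔸 := 𝔸) L BG BR B₀'H B₂' cL (ι j).η (ι j).k (ι j).Ω (ι j).Λs)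
    (SLetUB : ∀ j : J, ∀ α₀ : ℝ, 0 < α₀ → α₀ ≤ cL → ∀ U₀ : Site d → Fin d → 𝔸ˣ, (∀ x κ, U₀ x κ ∈ unitaryUnits 𝔸) →
      InAk L (ι j).k (ι j).η α₀ (ι j).Ω U₀ →
      ∃ (g Δ : (Site d → 𝔸) →ₗ[ℂ] (Site d → 𝔸)) (q : (Site d → 𝔸) →ₗ[ℂ] (ℕ → Site d → 𝔸)) (qs : (ℕ → Site d → 𝔸) →ₗ[ℂ] (Site d → 𝔸))
        (Aw c : (ℕ → Site d → 𝔸) →ₗ[ℂ] (ℕ → Site d → 𝔸)) (H' : XSpace d (ι j).k 𝔸 →ₗ[ℂ] (Site d → 𝔸)),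
        (∀ x : Site d → 𝔸, (∃ C : ℝ, ∀ y, ‖x y‖ ≤ C) → g (Δ x + qs (Aw (q x))) = x) ∧ (∀ φ, qs (c (q (g (g (qs φ))))) = qs φ) ∧
        (∀ (f : Site d → 𝔸), ∀ x ∈ (ι j).Ω 0, Δ f x = covLap (ι j).η U₀ (((ι j).Ω 0).indicator f) x) ∧
        (∀ (μ : ℕ → Site d → 𝔸), ∀ x ∈ (ι j).Ω 0, qs μ x = QT L (ι j).k ((ι j).Λs (ι j).k) U₀ μ x) ∧
        (∀ (f : Site d → 𝔸) (n : ℕ), n ≤ (ι j).k → ∀ y ∈ (ι j).Λs (ι j).k n, q f n y = QprimeIter (zdBlocking d L) (bgT L U₀) n f y) ∧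
        (∀ (f : Site d → 𝔸) (n : ℕ) (y : Site d), ¬ (n ≤ (ι j).k ∧ y ∈ (ι j).Λs (ι j).k n) → q f n y = 0) ∧
        (∀ (X : XSpace d (ι j).k 𝔸) (x : Site d), ‖H' X x‖ ≤ B₀'H * ‖X‖) ∧
        (∀ n, n ≤ (ι j).k → ∀ (X : XSpace d (ι j).k 𝔸), ∀ p ∈ {b : Site d × Fin d | SideTouches ((ι j).Ω n) b.1 b.2},
          wt L (ι j).η n * ‖covDerivFwd (ι j).η U₀ p.2 (H' X) p.1‖ ≤ B₀'H * ‖X‖) ∧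
        (∀ X : XSpace d (ι j).k 𝔸, Bd2 L (ι j).η (ι j).k (ι j).Ω (covLap (ι j).η U₀ (H' X)) (B₂' * ‖X‖)) ∧
        (∀ (Y : XSpace d (ι j).k 𝔸) (n : ℕ) (hn : n ≤ (ι j).k) (y : Site d), y ∈ (ι j).Λs (ι j).k n →
          QprimeIter (zdBlocking d L) (bgT L U₀) n (H' Y) y = Y (⟨n, Nat.lt_succ_of_le hn⟩, y)) ∧
        (∀ (f : Site d → 𝔸) (r : ℝ), 0 ≤ r → Bd2 L (ι j).η (ι j).k (ι j).Ω f r →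
          (∀ x, ‖g f x‖ ≤ BG * r) ∧ ∀ n, n ≤ (ι j).k → ∀ p ∈ {b : Site d × Fin d | SideTouches ((ι j).Ω n) b.1 b.2},
            wt L (ι j).η n * ‖covDerivFwd (ι j).η U₀ p.2 (g f) p.1‖ ≤ BG * r) ∧
        (∀ (f : Site d → 𝔸) (r : ℝ), 0 ≤ r → Bd2 L (ι j).η (ι j).k (ι j).Ω f r → Bd2 L (ι j).η (ι j).k (ι j).Ω (f - g (qs (c (q (g f))))) (BR * r)))
    (SB9all : ∀ j : J, ∀ m, m ≤ (ι j).k → SockB9P3 (𝔸 := 𝔸) L B₀ B₀β cB9 β len (ι j).η m (ι j).Ω (ι j).Λs (ι j).Λb) :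
    ∃ B₁ B₂ c₁ : ℝ, 0 < B₁ ∧ 0 < B₂ ∧ 0 < c₁ ∧
      ∀ i : J,
        (∀ ℓ, ℓ ≤ (ι i).k → ∀ w : Site d, (∀ x, InBox (tlo L w ℓ) (thi L w ℓ) x → x ∈ (ι i).Ω ℓ) →
          ∃ j, ℓ ≤ j ∧ j ≤ (ι i).k ∧ ∃ y ∈ (ι i).Λs (ι i).k j, Under L (j - ℓ) y w) →
        ∀ α₀ α₁ : ℝ, 0 < α₀ → 0 < α₁ → α₀ + α₁ ≤ c₁ →
          ∀ (U₀ : (zdGF3 𝔸 L β len (ι i)).Cfg) (P : (zdGF3 𝔸 L β len (ι i)).Pert),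
            (zdGF3 𝔸 L β len (ι i)).InA α₀ U₀ → (zdGF3 𝔸 L β len (ι i)).Reg335 α₀ U₀ → (zdGF3 𝔸 L β len (ι i)).InAAx α₀ U₀ P →
            (∀ j, j ≤ (ι i).k → ∀ (z : Site d) (μ : Fin d), BondTouches ((ι i).Λs (ι i).k j) z μ →
              (∀ x, InBox (loK L j z) (bondHiK L j z μ) x → x ∈ (ι i).Ω j) →
              ‖(avgIter L (mulCfg P.2.1 U₀.1) j z μ : 𝔸) - (avgIter L U₀.1 j z μ : 𝔸)‖ ≤ α₁) →
            ∃ u : (zdGF3 𝔸 L β len (ι i)).GT, (zdGF3 𝔸 L β len (ι i)).Restricted U₀ u ∧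
              ((zdGF3 𝔸 L β len (ι i)).C136 B₁ B₂ (α₀ + (11 * (d : ℝ) ^ 2 * α₀ + α₁)) U₀ ((zdGF3 𝔸 L β len (ι i)).act P u) ∧
                (zdGF3 𝔸 L β len (ι i)).C137 α₁ U₀ ((zdGF3 𝔸 L β len (ι i)).act P u) ∧
                (zdGF3 𝔸 L β len (ι i)).Landau U₀ ((zdGF3 𝔸 L β len (ι i)).act P u) ∧
                (zdGF3 𝔸 L β len (ι i)).C139 B₁ (α₀ + (11 * (d : ℝ) ^ 2 * α₀ + α₁)) U₀ ((zdGF3 𝔸 L β len (ι i)).act P u)) ∧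
              ∀ u' : (zdGF3 𝔸 L β len (ι i)).GT, (zdGF3 𝔸 L β len (ι i)).Restricted U₀ u' →
                (zdGF3 𝔸 L β len (ι i)).C136 B₁ B₂ (α₀ + (11 * (d : ℝ) ^ 2 * α₀ + α₁)) U₀ ((zdGF3 𝔸 L β len (ι i)).act P u') →
                (zdGF3 𝔸 L β len (ι i)).C137 α₁ U₀ ((zdGF3 𝔸 L β len (ι i)).act P u') →
                (zdGF3 𝔸 L β len (ι i)).Landau U₀ ((zdGF3 𝔸 L β len (ι i)).act P u') →
                (zdGF3 𝔸 L β len (ι i)).C139 B₁ (α₀ + (11 * (d : ℝ) ^ 2 * α₀ + α₁)) U₀ ((zdGF3 𝔸 L β len (ι i)).act P u') →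
                  u' = u := by
  obtain ⟨cF, hcF, hpair⟩ := exists_threshold_sockHFP_pairRD (𝔸 := 𝔸) (B₀ := B₀) (B₀' := B₀') hd2 hL hB₀ hB₀' hB hB₀'H hB₂' hBG hBR hcB9 hcL hfree
  obtain ⟨cu, cFu, hcu, hcFu, huniq⟩ := exists_threshold_sockP5uEB (𝔸 := 𝔸) hd2 hL hB₀ hB hB₀'H hB₂' hBG hBR hcB9 hcL
  exact thm2_of135_zd3_map_b9allE hd2 hL hB₀ hB₀' hB₀β hB hcu hcF hcF hcFu hcB9 ι hΩ
    (fun j => (hpair (ι j).hη (ι j).hk (ι j).hΩ (ι j).hbox (ι j).hclass (hL1 j) (hL2lt j) (hL2top j) (SLet j) (SB9all j)).1)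
    (fun j => (hpair (ι j).hη (ι j).hk (ι j).hΩ (ι j).hbox (ι j).hclass (hL1 j) (hL2lt j) (hL2top j) (SLet j) (SB9all j)).2)
    (fun j => huniq (ι j).hη (ι j).hk (ι j).hΩ (hΩ j) (ι j).hbox (ι j).hclass ((hL1 j) (ι j).k le_rfl) (SLetUB j) (SB9all j))
    SB9all

end Thm2RDUB

#print axioms b8LeafRS_zd3_map_lettersRDUB
#print axioms thm2_of135_zd3_map_lettersRDUB

end Literature.MathematicalPhysics.QuantumFieldTheory.Balaban1983to89.B8LeafKnitZd3LettersRDB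

end
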